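import Literature.MathematicalPhysics.QuantumFieldTheory.ConformalBootstrap3D.CasimirPairStencil
import Literature.MathematicalPhysics.QuantumFieldTheory.ConformalBootstrap3D.MixedBlockCoefficients
import Mathlib.Tactic
import HarnessLib

/-!
# The Casimir pair for UNEQUAL external dimensions: the `(a,b)` quadratic stencil and its closure stencil

`CasimirPairStencil` treats the Hogervorst–Rychkov frame for equal external dimensions (`a = b = 0`):
the quadratic Casimir `𝒟₂` is a three-point stencil on arrays `x : ℤ → ℤ → ℝ` (coefficient of `𝒫_{E₀+M,j}`),
and the closure operator `𝕃_p = 𝒟₄ - (𝒟₂-c₀)(𝒟₂-c₁)` a four-point stencil commuting with it, of which the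
block arrays `A(Δ,ℓ)` are eigen-arrays with diagonal symbol `ℓ_p(E,j) = clDiag p E j`. For general external
dimensions (`a = -Δ₁₂/2`, `b = Δ₃₄/2`, Dolan–Osborn 2004 §3) the quadratic recursion acquires the weights
`γ^±_{E,j}(a,b)` of `MixedBlockCoefficients` (`hrGammaPlusAB`, `hrGammaMinusAB`: every square `(E+j)²`,
`(E-j-1)²` of the equal case becomes `(E+j+2a)(E+j+2b)`, `(E-j-1+2a)(E-j-1+2b)`; the diagonal `C_{E,j}` is
unchanged), and the block array is `A(a,b;Δ,ℓ) = hrCoeffAB a b Δ ℓ` (Dolan–Osborn 2004 eqs. (3.9)–(3.12)).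
This file transcribes the same substitution in the closure stencil and PROVES everything used downstream:

* `opD2AB a b E₀` — the `(a,b)` three-point stencil (`d2diag`, `d2upAB`, `d2dnAB`);
* `opLAB a b s E₀` — the four-point stencil with the SAME diagonal `clDiag s` (base parameter `s`, for the
  mean-field application `s = (p+q)/2`) and the shifted off-diagonal coefficients `clUpAB`, `clDnAB`,
  `clTwoAB` (the `𝒫`-basis expansion of Dolan–Osborn's `Δ₄^{(a,b)} - (Δ₂^{(a,b)}-c₀)(Δ₂^{(a,b)}-c₁)`,
  arXiv:1108.6194 §4.2, obtained with computer algebra, pub-ising3d-lit-g9 `code/mft3d_d4_ab.py`; what is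
  PROVED is all that is used: `opD2AB_opLAB_comm` — the stencils commute, seven rational identities
  `commAB_coef₁`–`commAB_coef₇`, for ALL `a, b, s`);
* `hrCoeffZAB a b Δ ℓ` — the `(a,b)` block array on `ℤ × ℤ`; `opD2AB_hrCoeffZAB` — it is an eigen-array of
  `opD2AB a b Δ` with eigenvalue `C_{Δ,ℓ}` above the unitarity bound (the recursion `hrCoeffAB_succ_rec`, pivots
  `casimirPivot3D_pos`); `eq_smul_hrCoeffZAB_of_eigen` — uniqueness of range-supported eigen-arrays with given
  apex; `opLAB_hrCoeffZAB` — hence `𝕃^{(a,b)}_s A(a,b;Δ,ℓ) = ℓ_s(Δ,ℓ) A(a,b;Δ,ℓ)`, the SAME diagonal symbol as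
  in the equal case (it is `a,b`-free), vanishing exactly on the leading twist `Δ = 2s + ℓ`.

At `a = b = 0`, `s = p` these are the objects of `CasimirPairStencil` (`d2upAB_zero_zero`, …,
`hrCoeffZAB_zero_zero`). Cross-checks (exact, not part of the proofs): the commutation symbolically in
`(E, j, a, b, s)` (pub-ising3d-lit-g10 `code/ab_stencil_comm.py`).
[cite: DolanOsborn2004, §3 eqs. (3.9)–(3.12)] [cite: DolanOsborn2011, §4.2] [cite: HogervorstRychkov2013, §3 eqs. (3.6)–(3.9)]
-/

namespace Literature.MathematicalPhysics.QuantumFieldTheory.ConformalBootstrap3D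

open Finset

/-! ### Coefficient functions (real arguments `E`, `j`) -/

/-- Coefficient of `𝒫_{E+1,j+1}` in `𝒟₂^{(a,b)} 𝒫_{E,j}`: `-½γ⁺_{E,j}(a,b) = -(j+1)(E+j+2a)(E+j+2b)/(2(2j+1))`.
[cite: DolanOsborn2004, §3 eqs. (3.9), (3.11)] -/
noncomputable def d2upAB (a b E j : ℝ) : ℝ := -((j + 1) * (E + j + 2 * a) * (E + j + 2 * b)) / (2 * (2 * j + 1))

/-- Coefficient of `𝒫_{E+1,j-1}` in `𝒟₂^{(a,b)} 𝒫_{E,j}`: `-½γ⁻_{E,j}(a,b) = -j(E-j-1+2a)(E-j-1+2b)/(2(2j+1))`.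
[cite: DolanOsborn2004, §3 eqs. (3.9), (3.11)] -/
noncomputable def d2dnAB (a b E j : ℝ) : ℝ := -(j * (E - j - 1 + 2 * a) * (E - j - 1 + 2 * b)) / (2 * (2 * j + 1))

/-- Coefficient of `𝒫_{E+1,j+1}` in `𝕃^{(a,b)}_s 𝒫_{E,j}`. [cite: DolanOsborn2011, §4.2] -/
noncomputable def clUpAB (a b s E j : ℝ) : ℝ :=
  -((j + 1) * (E + j + 2 * a) * (E + j + 2 * b) * (2 * s - E + j) * (2 * s + E - j - 4)) / (2 * (2 * j + 1))

/-- Coefficient of `𝒫_{E+1,j-1}` in `𝕃^{(a,b)}_s 𝒫_{E,j}`. [cite: DolanOsborn2011, §4.2] -/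
noncomputable def clDnAB (a b s E j : ℝ) : ℝ :=
  -(j * (E - j - 1 + 2 * a) * (E - j - 1 + 2 * b) * (2 * s - E - j - 1) * (2 * s + E + j - 3)) / (2 * (2 * j + 1))

/-- Coefficient of `𝒫_{E+2,j}` in `𝕃^{(a,b)}_s 𝒫_{E,j}` (independent of `s`):
`-(E+j+2a)(E+j+2b)(E-j-1+2a)(E-j-1+2b)/4`. [cite: DolanOsborn2011, §4.2] -/
noncomputable def clTwoAB (a b E j : ℝ) : ℝ :=
  -((E + j + 2 * a) * (E + j + 2 * b) * (E - j - 1 + 2 * a) * (E - j - 1 + 2 * b)) / 4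

/-- At `a = b = 0`: `d2upAB 0 0 = d2up`. [cite: HogervorstRychkov2013, §3 eq. (3.8)] -/
@[simp] theorem d2upAB_zero_zero (E j : ℝ) : d2upAB 0 0 E j = d2up E j := by
  unfold d2upAB d2up; ring

/-- At `a = b = 0`: `d2dnAB 0 0 = d2dn`. [cite: HogervorstRychkov2013, §3 eq. (3.8)] -/
@[simp] theorem d2dnAB_zero_zero (E j : ℝ) : d2dnAB 0 0 E j = d2dn E j := by
  unfold d2dnAB d2dn; ring

/-- At `a = b = 0`: `clUpAB 0 0 p = clUp p`. [folklore] -/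
@[simp] theorem clUpAB_zero_zero (p E j : ℝ) : clUpAB 0 0 p E j = clUp p E j := by
  unfold clUpAB clUp; ring

/-- At `a = b = 0`: `clDnAB 0 0 p = clDn p`. [folklore] -/
@[simp] theorem clDnAB_zero_zero (p E j : ℝ) : clDnAB 0 0 p E j = clDn p E j := by
  unfold clDnAB clDn; ring

/-- At `a = b = 0`: `clTwoAB 0 0 = clTwo`. [folklore] -/
@[simp] theorem clTwoAB_zero_zero (E j : ℝ) : clTwoAB 0 0 E j = clTwo E j := by
  unfold clTwoAB clTwo; ring

/-- `d2upAB a b E j = -γ⁺_{E,j}(a,b)/2`. [cite: DolanOsborn2004, §3 eq. (3.9)] -/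
theorem d2upAB_eq (a b E : ℝ) (j : ℕ) : d2upAB a b E j = -(hrGammaPlusAB a b E j) / 2 := by
  unfold d2upAB hrGammaPlusAB
  have h : (2 * (j : ℝ) + 1) ≠ 0 := by positivity
  field_simp

/-- `d2dnAB a b E j = -γ⁻_{E,j}(a,b)/2`. [cite: DolanOsborn2004, §3 eq. (3.9)] -/
theorem d2dnAB_eq (a b E : ℝ) (j : ℕ) : d2dnAB a b E j = -(hrGammaMinusAB a b E j) / 2 := by
  unfold d2dnAB hrGammaMinusAB
  have h : (2 * (j : ℝ) + 1) ≠ 0 := by positivity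
  field_simp

/-- `d2dnAB a b E 0 = 0`. [folklore] -/
@[simp] theorem d2dnAB_zero (a b E : ℝ) : d2dnAB a b E 0 = 0 := by simp [d2dnAB]

/-- `clDnAB a b s E 0 = 0`. [folklore] -/
@[simp] theorem clDnAB_zero (a b s E : ℝ) : clDnAB a b s E 0 = 0 := by simp [clDnAB]

/-- The coefficients are symmetric in `(a,b)`. [folklore] -/
theorem clTwoAB_comm (a b E j : ℝ) : clTwoAB a b E j = clTwoAB b a E j := by
  unfold clTwoAB; ring

/-- `clUpAB` vanishes on the leading twist of the frame `s`: `clUpAB a b s (2s+j) j = 0`. [folklore] -/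
theorem clUpAB_leading (a b s j : ℝ) : clUpAB a b s (2 * s + j) j = 0 := by
  unfold clUpAB; ring

/-- `clUpAB a b s E (-1) = 0`. [folklore] -/
theorem clUpAB_neg_one (a b s E : ℝ) : clUpAB a b s E (-1) = 0 := by
  unfold clUpAB; ring

/-! ### The two stencils as operators on `ℤ × ℤ`-indexed arrays -/

/-- The `(a,b)` quadratic Casimir in the Hogervorst–Rychkov frame with base `E₀`, pull form:
`(𝒟₂x)_{M,j} = C_{E,j} x_{M,j} - ½γ⁺_{E-1,j-1}(a,b) x_{M-1,j-1} - ½γ⁻_{E-1,j+1}(a,b) x_{M-1,j+1}`, `E = E₀ + M`.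
[cite: DolanOsborn2004, §3 eqs. (3.9)–(3.12)] -/
noncomputable def opD2AB (a b E₀ : ℝ) (x : ℤ → ℤ → ℝ) : ℤ → ℤ → ℝ := fun M j =>
  d2diag (E₀ + (M : ℝ)) (j : ℝ) * x M j +
    d2upAB a b (E₀ + ((M - 1 : ℤ) : ℝ)) ((j - 1 : ℤ) : ℝ) * x (M - 1) (j - 1) +
    d2dnAB a b (E₀ + ((M - 1 : ℤ) : ℝ)) ((j + 1 : ℤ) : ℝ) * x (M - 1) (j + 1)

/-- The `(a,b)` closure stencil with base parameter `s` in the frame with base `E₀`, pull form (four-point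
stencil `(0,0)`, `(1,±1)`, `(2,0)`). [cite: DolanOsborn2011, §4.2] -/
noncomputable def opLAB (a b s E₀ : ℝ) (x : ℤ → ℤ → ℝ) : ℤ → ℤ → ℝ := fun M j =>
  clDiag s (E₀ + (M : ℝ)) (j : ℝ) * x M j +
    clUpAB a b s (E₀ + ((M - 1 : ℤ) : ℝ)) ((j - 1 : ℤ) : ℝ) * x (M - 1) (j - 1) +
    clDnAB a b s (E₀ + ((M - 1 : ℤ) : ℝ)) ((j + 1 : ℤ) : ℝ) * x (M - 1) (j + 1) +
    clTwoAB a b (E₀ + ((M - 2 : ℤ) : ℝ)) (j : ℝ) * x (M - 2) j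

/-- At `a = b = 0` the quadratic stencil is `opD2`. [folklore] -/
theorem opD2AB_zero_zero (E₀ : ℝ) (x : ℤ → ℤ → ℝ) : opD2AB 0 0 E₀ x = opD2 E₀ x := by
  funext M j; simp only [opD2AB, opD2, d2upAB_zero_zero, d2dnAB_zero_zero]

/-- At `a = b = 0`, `s = p` the closure stencil is `opL p`. [folklore] -/
theorem opLAB_zero_zero (p E₀ : ℝ) (x : ℤ → ℤ → ℝ) : opLAB 0 0 p E₀ x = opL p E₀ x := by
  funext M j; simp only [opLAB, opL, clUpAB_zero_zero, clDnAB_zero_zero, clTwoAB_zero_zero]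

/-- `opD2AB` is linear: subtraction. [folklore] -/
theorem opD2AB_sub (a b E₀ : ℝ) (x y : ℤ → ℤ → ℝ) :
    opD2AB a b E₀ (fun M j => x M j - y M j) = fun M j => opD2AB a b E₀ x M j - opD2AB a b E₀ y M j := by
  funext M j; simp only [opD2AB]; ring

/-- `opLAB` is linear: subtraction. [folklore] -/
theorem opLAB_sub (a b s E₀ : ℝ) (x y : ℤ → ℤ → ℝ) :
    opLAB a b s E₀ (fun M j => x M j - y M j) = fun M j => opLAB a b s E₀ x M j - opLAB a b s E₀ y M j := by
  funext M j; simp only [opLAB]; ring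

/-- `opLAB` is linear: scalars. [folklore] -/
theorem opLAB_smul (a b s E₀ c : ℝ) (x : ℤ → ℤ → ℝ) :
    opLAB a b s E₀ (fun M j => c * x M j) = fun M j => c * opLAB a b s E₀ x M j := by
  funext M j; simp only [opLAB]; ring

/-- `opD2AB` is linear: scalars. [folklore] -/
theorem opD2AB_smul (a b E₀ c : ℝ) (x : ℤ → ℤ → ℝ) :
    opD2AB a b E₀ (fun M j => c * x M j) = fun M j => c * opD2AB a b E₀ x M j := by
  funext M j; simp only [opD2AB]; ring

/-- Shifting the base: `opD2AB a b E₀` on an array shifted up by `M₀` levels is `opD2AB a b (E₀+M₀)` shifted.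
[folklore] -/
theorem opD2AB_shift (a b E₀ : ℝ) (M₀ : ℤ) (x : ℤ → ℤ → ℝ) :
    opD2AB a b E₀ (fun M j => x (M - M₀) j) = fun M j => opD2AB a b (E₀ + M₀) x (M - M₀) j := by
  funext M j
  simp only [opD2AB]
  have e1 : M - 1 - M₀ = M - M₀ - 1 := by ring
  have e2 : (E₀ + ((M - 1 : ℤ) : ℝ)) = E₀ + (M₀ : ℝ) + ((M - M₀ - 1 : ℤ) : ℝ) := by push_cast; ring
  have e3 : (E₀ + (M : ℝ)) = E₀ + (M₀ : ℝ) + ((M - M₀ : ℤ) : ℝ) := by push_cast; ring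
  rw [e1, e2, e3]

/-- Shifting the base for `opLAB`. [folklore] -/
theorem opLAB_shift (a b s E₀ : ℝ) (M₀ : ℤ) (x : ℤ → ℤ → ℝ) :
    opLAB a b s E₀ (fun M j => x (M - M₀) j) = fun M j => opLAB a b s (E₀ + M₀) x (M - M₀) j := by
  funext M j
  simp only [opLAB]
  have e1 : M - 1 - M₀ = M - M₀ - 1 := by ring
  have e1' : M - 2 - M₀ = M - M₀ - 2 := by ring
  have e2 : (E₀ + ((M - 1 : ℤ) : ℝ)) = E₀ + (M₀ : ℝ) + ((M - M₀ - 1 : ℤ) : ℝ) := by push_cast; ring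
  have e2' : (E₀ + ((M - 2 : ℤ) : ℝ)) = E₀ + (M₀ : ℝ) + ((M - M₀ - 2 : ℤ) : ℝ) := by push_cast; ring
  have e3 : (E₀ + (M : ℝ)) = E₀ + (M₀ : ℝ) + ((M - M₀ : ℤ) : ℝ) := by push_cast; ring
  rw [e1, e1', e2, e2', e3]

/-! ### Commutation of the two stencils -/

section comm
variable (a b s E₀ : ℝ) (M j : ℤ)

/-- Commutator coefficient at `x_{M-1,j-1}` vanishes. [cite: DolanOsborn2011, §4.2] -/
theorem commAB_coef₁ :
    d2diag (E₀ + (M : ℝ)) (j : ℝ) * clUpAB a b s (E₀ + ((M - 1 : ℤ) : ℝ)) ((j - 1 : ℤ) : ℝ) +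
        d2upAB a b (E₀ + ((M - 1 : ℤ) : ℝ)) ((j - 1 : ℤ) : ℝ) * clDiag s (E₀ + ((M - 1 : ℤ) : ℝ)) ((j - 1 : ℤ) : ℝ) =
      clDiag s (E₀ + (M : ℝ)) (j : ℝ) * d2upAB a b (E₀ + ((M - 1 : ℤ) : ℝ)) ((j - 1 : ℤ) : ℝ) +
        clUpAB a b s (E₀ + ((M - 1 : ℤ) : ℝ)) ((j - 1 : ℤ) : ℝ) * d2diag (E₀ + ((M - 1 : ℤ) : ℝ)) ((j - 1 : ℤ) : ℝ) := by
  have h := two_mul_intCast_add_one_ne_zero (j - 1)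
  push_cast at h ⊢
  simp only [d2diag, d2upAB, clDiag, clUpAB]
  field_simp
  ring

/-- Commutator coefficient at `x_{M-1,j+1}` vanishes. [cite: DolanOsborn2011, §4.2] -/
theorem commAB_coef₂ :
    d2diag (E₀ + (M : ℝ)) (j : ℝ) * clDnAB a b s (E₀ + ((M - 1 : ℤ) : ℝ)) ((j + 1 : ℤ) : ℝ) +
        d2dnAB a b (E₀ + ((M - 1 : ℤ) : ℝ)) ((j + 1 : ℤ) : ℝ) * clDiag s (E₀ + ((M - 1 : ℤ) : ℝ)) ((j + 1 : ℤ) : ℝ) =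
      clDiag s (E₀ + (M : ℝ)) (j : ℝ) * d2dnAB a b (E₀ + ((M - 1 : ℤ) : ℝ)) ((j + 1 : ℤ) : ℝ) +
        clDnAB a b s (E₀ + ((M - 1 : ℤ) : ℝ)) ((j + 1 : ℤ) : ℝ) * d2diag (E₀ + ((M - 1 : ℤ) : ℝ)) ((j + 1 : ℤ) : ℝ) := by
  have h := two_mul_intCast_add_one_ne_zero (j + 1)
  push_cast at h ⊢
  simp only [d2diag, d2dnAB, clDiag, clDnAB]
  field_simp
  ring

set_option maxHeartbeats 1600000 in
/-- Commutator coefficient at `x_{M-2,j}` vanishes. [cite: DolanOsborn2011, §4.2] -/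
theorem commAB_coef₃ :
    d2diag (E₀ + (M : ℝ)) (j : ℝ) * clTwoAB a b (E₀ + ((M - 2 : ℤ) : ℝ)) (j : ℝ) +
        d2upAB a b (E₀ + ((M - 1 : ℤ) : ℝ)) ((j - 1 : ℤ) : ℝ) * clDnAB a b s (E₀ + ((M - 2 : ℤ) : ℝ)) (j : ℝ) +
        d2dnAB a b (E₀ + ((M - 1 : ℤ) : ℝ)) ((j + 1 : ℤ) : ℝ) * clUpAB a b s (E₀ + ((M - 2 : ℤ) : ℝ)) (j : ℝ) =
      clUpAB a b s (E₀ + ((M - 1 : ℤ) : ℝ)) ((j - 1 : ℤ) : ℝ) * d2dnAB a b (E₀ + ((M - 2 : ℤ) : ℝ)) (j : ℝ) +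
        clDnAB a b s (E₀ + ((M - 1 : ℤ) : ℝ)) ((j + 1 : ℤ) : ℝ) * d2upAB a b (E₀ + ((M - 2 : ℤ) : ℝ)) (j : ℝ) +
        clTwoAB a b (E₀ + ((M - 2 : ℤ) : ℝ)) (j : ℝ) * d2diag (E₀ + ((M - 2 : ℤ) : ℝ)) (j : ℝ) := by
  have h1 := two_mul_intCast_add_one_ne_zero j
  have h2 := two_mul_intCast_add_one_ne_zero (j - 1)
  have h3 := two_mul_intCast_add_one_ne_zero (j + 1)
  push_cast at h1 h2 h3 ⊢
  have h2' : (2 * (j : ℝ) - 1) ≠ 0 := fun h => h2 (by linarith)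
  have h3' : (2 * (j : ℝ) + 3) ≠ 0 := fun h => h3 (by linarith)
  simp only [d2diag, d2upAB, d2dnAB, clUpAB, clDnAB, clTwoAB, div_mul_div_comm]
  have hA : (2 : ℝ) * (2 * (2 * ((j : ℝ) - 1) + 1)) ≠ 0 := mul_ne_zero two_ne_zero (mul_ne_zero two_ne_zero h2)
  have hB : (2 * (2 * ((j : ℝ) - 1) + 1)) * (2 * (2 * (j : ℝ) + 1)) ≠ 0 :=
    mul_ne_zero (mul_ne_zero two_ne_zero h2) (mul_ne_zero two_ne_zero h1)
  have hC : (2 * (2 * ((j : ℝ) + 1) + 1)) * (2 * (2 * (j : ℝ) + 1)) ≠ 0 :=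
    mul_ne_zero (mul_ne_zero two_ne_zero h3) (mul_ne_zero two_ne_zero h1)
  have hD : (2 : ℝ) * 4 ≠ 0 := by norm_num
  have hD' : (4 : ℝ) * 2 ≠ 0 := by norm_num
  rw [div_add_div _ _ hD hB, div_add_div _ _ (mul_ne_zero hD hB) hC,
    div_add_div _ _ hB hC, div_add_div _ _ (mul_ne_zero hB hC) hD',
    div_eq_div_iff (mul_ne_zero (mul_ne_zero hD hB) hC) (mul_ne_zero (mul_ne_zero hB hC) hD')]
  ring

/-- Commutator coefficient at `x_{M-2,j-2}` vanishes. [cite: DolanOsborn2011, §4.2] -/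
theorem commAB_coef₄ :
    d2upAB a b (E₀ + ((M - 1 : ℤ) : ℝ)) ((j - 1 : ℤ) : ℝ) * clUpAB a b s (E₀ + ((M - 2 : ℤ) : ℝ)) ((j - 2 : ℤ) : ℝ) =
      clUpAB a b s (E₀ + ((M - 1 : ℤ) : ℝ)) ((j - 1 : ℤ) : ℝ) * d2upAB a b (E₀ + ((M - 2 : ℤ) : ℝ)) ((j - 2 : ℤ) : ℝ) := by
  have h2 := two_mul_intCast_add_one_ne_zero (j - 1)
  have h4 := two_mul_intCast_add_one_ne_zero (j - 2)
  push_cast at h2 h4 ⊢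
  simp only [d2upAB, clUpAB]
  field_simp
  ring

/-- Commutator coefficient at `x_{M-2,j+2}` vanishes. [cite: DolanOsborn2011, §4.2] -/
theorem commAB_coef₅ :
    d2dnAB a b (E₀ + ((M - 1 : ℤ) : ℝ)) ((j + 1 : ℤ) : ℝ) * clDnAB a b s (E₀ + ((M - 2 : ℤ) : ℝ)) ((j + 2 : ℤ) : ℝ) =
      clDnAB a b s (E₀ + ((M - 1 : ℤ) : ℝ)) ((j + 1 : ℤ) : ℝ) * d2dnAB a b (E₀ + ((M - 2 : ℤ) : ℝ)) ((j + 2 : ℤ) : ℝ) := by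
  have h3 := two_mul_intCast_add_one_ne_zero (j + 1)
  have h5 := two_mul_intCast_add_one_ne_zero (j + 2)
  push_cast at h3 h5 ⊢
  simp only [d2dnAB, clDnAB]
  field_simp
  ring

/-- Commutator coefficient at `x_{M-3,j-1}` vanishes. [cite: DolanOsborn2011, §4.2] -/
theorem commAB_coef₆ :
    d2upAB a b (E₀ + ((M - 1 : ℤ) : ℝ)) ((j - 1 : ℤ) : ℝ) * clTwoAB a b (E₀ + ((M - 3 : ℤ) : ℝ)) ((j - 1 : ℤ) : ℝ) =
      clTwoAB a b (E₀ + ((M - 2 : ℤ) : ℝ)) (j : ℝ) * d2upAB a b (E₀ + ((M - 3 : ℤ) : ℝ)) ((j - 1 : ℤ) : ℝ) := by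
  have h2 := two_mul_intCast_add_one_ne_zero (j - 1)
  push_cast at h2 ⊢
  simp only [d2upAB, clTwoAB]
  field_simp
  ring

/-- Commutator coefficient at `x_{M-3,j+1}` vanishes. [cite: DolanOsborn2011, §4.2] -/
theorem commAB_coef₇ :
    d2dnAB a b (E₀ + ((M - 1 : ℤ) : ℝ)) ((j + 1 : ℤ) : ℝ) * clTwoAB a b (E₀ + ((M - 3 : ℤ) : ℝ)) ((j + 1 : ℤ) : ℝ) =
      clTwoAB a b (E₀ + ((M - 2 : ℤ) : ℝ)) (j : ℝ) * d2dnAB a b (E₀ + ((M - 3 : ℤ) : ℝ)) ((j + 1 : ℤ) : ℝ) := by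
  have h3 := two_mul_intCast_add_one_ne_zero (j + 1)
  push_cast at h3 ⊢
  simp only [d2dnAB, clTwoAB]
  field_simp
  ring

end comm

/-- **The `(a,b)` closure stencil commutes with the `(a,b)` quadratic stencil**: `𝒟₂ 𝕃 = 𝕃 𝒟₂` as operators
on arrays, for all `a, b, s, E₀` (Dolan–Osborn 2011 §4.2: `[Δ₂, Δ₄] = 0`; here the seven rational identities
`commAB_coef₁`–`commAB_coef₇`). [cite: DolanOsborn2011, §4.2] -/
theorem opD2AB_opLAB_comm (a b s E₀ : ℝ) (x : ℤ → ℤ → ℝ) :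
    opD2AB a b E₀ (opLAB a b s E₀ x) = opLAB a b s E₀ (opD2AB a b E₀ x) := by
  funext M j
  simp only [opD2AB, opLAB]
  have i1 : M - 1 - 1 = M - 2 := by ring
  have i2 : j - 1 - 1 = j - 2 := by ring
  have i5 : j + 1 + 1 = j + 2 := by ring
  have i6 : M - 1 - 2 = M - 3 := by ring
  have i7 : M - 2 - 1 = M - 3 := by ring
  simp only [i1, i2, i5, i6, i7, sub_add_cancel, add_sub_cancel_right]
  linear_combination (x (M - 1) (j - 1)) * commAB_coef₁ a b s E₀ M j +
    (x (M - 1) (j + 1)) * commAB_coef₂ a b s E₀ M j +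
    (x (M - 2) j) * commAB_coef₃ a b s E₀ M j + (x (M - 2) (j - 2)) * commAB_coef₄ a b s E₀ M j +
    (x (M - 2) (j + 2)) * commAB_coef₅ a b s E₀ M j + (x (M - 3) (j - 1)) * commAB_coef₆ a b E₀ M j +
    (x (M - 3) (j + 1)) * commAB_coef₇ a b E₀ M j

/-! ### The `(a,b)` block array on `ℤ × ℤ` and its eigen-properties -/

/-- The Dolan–Osborn coefficient array `A_{n,j}(a,b;Δ,ℓ)` extended by zero to `ℤ × ℤ`.
[cite: DolanOsborn2004, §3 eqs. (3.9)–(3.12)] -/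
noncomputable def hrCoeffZAB (a b Δ : ℝ) (ℓ : ℕ) (n j : ℤ) : ℝ :=
  if 0 ≤ n ∧ 0 ≤ j then hrCoeffAB a b Δ ℓ n.toNat j.toNat else 0

/-- On natural indices `hrCoeffZAB` is `hrCoeffAB`. [folklore] -/
theorem hrCoeffZAB_natCast (a b Δ : ℝ) (ℓ n j : ℕ) :
    hrCoeffZAB a b Δ ℓ (n : ℤ) (j : ℤ) = hrCoeffAB a b Δ ℓ n j := by
  simp [hrCoeffZAB]

/-- At `a = b = 0` this is `hrCoeffZ`. [cite: DolanOsborn2004, §3 eq. (3.11)] -/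
theorem hrCoeffZAB_zero_zero (Δ : ℝ) (ℓ : ℕ) : hrCoeffZAB 0 0 Δ ℓ = hrCoeffZ Δ ℓ := by
  funext n j
  unfold hrCoeffZAB hrCoeffZ
  split_ifs
  · rw [hrCoeffAB_zero_zero]
  · rfl

/-- `hrCoeffZAB` vanishes at negative level. [folklore] -/
theorem hrCoeffZAB_of_neg_left (a b Δ : ℝ) (ℓ : ℕ) {n : ℤ} (hn : n < 0) (j : ℤ) :
    hrCoeffZAB a b Δ ℓ n j = 0 := by
  simp [hrCoeffZAB, not_le.mpr hn]

/-- `hrCoeffZAB` vanishes at negative spin. [folklore] -/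
theorem hrCoeffZAB_of_neg_right (a b Δ : ℝ) (ℓ : ℕ) (n : ℤ) {j : ℤ} (hj : j < 0) :
    hrCoeffZAB a b Δ ℓ n j = 0 := by
  simp [hrCoeffZAB, not_le.mpr hj]

/-- `hrCoeffZAB` is supported on the descendant range. [cite: DolanOsborn2004, §3 eq. (3.10)] -/
theorem hrCoeffZAB_eq_zero_of_not_inRangeZ (a b Δ : ℝ) (ℓ : ℕ) {n j : ℤ} (h : ¬ InRangeZ ℓ n j) :
    hrCoeffZAB a b Δ ℓ n j = 0 := by
  unfold hrCoeffZAB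
  split_ifs with hnj
  · obtain ⟨hn, hj⟩ := hnj
    obtain ⟨n', rfl⟩ := Int.eq_ofNat_of_zero_le hn
    obtain ⟨j', rfl⟩ := Int.eq_ofNat_of_zero_le hj
    simp only [Int.toNat_natCast]
    apply hrCoeffAB_eq_zero_of_not_inDescendantRange
    rwa [← inRangeZ_natCast]
  · rfl

/-- Unfolding `opD2AB` at a natural point `(m+1, j)` with natural casts. [folklore] -/
theorem opD2AB_apply_succ (a b E₀ : ℝ) (x : ℤ → ℤ → ℝ) (m j : ℕ) :
    opD2AB a b E₀ x ((m : ℤ) + 1) (j : ℤ) =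
      d2diag (E₀ + ((m : ℝ) + 1)) (j : ℝ) * x ((m : ℤ) + 1) j +
        d2upAB a b (E₀ + (m : ℝ)) ((j : ℝ) - 1) * x m ((j : ℤ) - 1) +
        d2dnAB a b (E₀ + (m : ℝ)) ((j : ℝ) + 1) * x m ((j : ℤ) + 1) := by
  simp only [opD2AB]
  push_cast
  simp only [add_sub_cancel_right]

/-- Unfolding `opD2AB` at level `0` for an array vanishing at level `-1`. [folklore] -/
theorem opD2AB_apply_zero (a b E₀ : ℝ) (x : ℤ → ℤ → ℝ) (hx : ∀ j, x (-1) j = 0) (j : ℤ) :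
    opD2AB a b E₀ x 0 j = d2diag E₀ j * x 0 j := by
  simp only [opD2AB]
  have e : (0 : ℤ) - 1 = -1 := by norm_num
  rw [e, hx, hx]
  push_cast
  ring

/-- Unfolding `opLAB` at level `0` for an array vanishing at levels `-1`, `-2`. [folklore] -/
theorem opLAB_apply_zero (a b s E₀ : ℝ) (x : ℤ → ℤ → ℝ) (hx : ∀ j, x (-1) j = 0) (hx2 : ∀ j, x (-2) j = 0)
    (j : ℤ) : opLAB a b s E₀ x 0 j = clDiag s E₀ j * x 0 j := by
  simp only [opLAB]
  have e : (0 : ℤ) - 1 = -1 := by norm_num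
  have e2 : (0 : ℤ) - 2 = -2 := by norm_num
  rw [e, e2, hx, hx, hx2]
  push_cast
  ring

/-- **The `(a,b)` block array is an eigen-array of the `(a,b)` quadratic stencil**: for `Δ` strictly above the
unitarity bound, `𝒟₂^{(a,b)} A(a,b;Δ,ℓ) = C_{Δ,ℓ} A(a,b;Δ,ℓ)` entrywise on `ℤ × ℤ` (the recursion (3.12) where
the pivot is positive; both sides zero off the descendant range and at negative indices).
[cite: DolanOsborn2004, §3 eqs. (3.9)–(3.12)] -/
theorem opD2AB_hrCoeffZAB {Δ : ℝ} {ℓ : ℕ} (a b : ℝ) (hΔ : unitarityBound3D ℓ < Δ) :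
    opD2AB a b Δ (hrCoeffZAB a b Δ ℓ) = fun n j => casimirEigenvalue3D Δ ℓ * hrCoeffZAB a b Δ ℓ n j := by
  funext n j
  -- negative spin: everything vanishes (`d2dnAB _ _ _ 0 = 0` handles `j = -1`)
  by_cases hj : 0 ≤ j
  swap
  · have hj' : j < 0 := not_le.mp hj
    simp only [opD2AB]
    rw [hrCoeffZAB_of_neg_right _ _ _ _ _ hj', hrCoeffZAB_of_neg_right _ _ _ _ _ (by omega : j - 1 < 0)]
    rcases lt_or_eq_of_le (show j + 1 ≤ 0 by omega) with h | h
    · rw [hrCoeffZAB_of_neg_right _ _ _ _ _ h]; ring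
    · rw [h]; push_cast; simp
  -- negative level
  by_cases hn : 0 ≤ n
  swap
  · have hn' : n < 0 := not_le.mp hn
    simp only [opD2AB]
    rw [hrCoeffZAB_of_neg_left _ _ _ _ hn', hrCoeffZAB_of_neg_left _ _ _ _ (by omega : n - 1 < 0),
      hrCoeffZAB_of_neg_left _ _ _ _ (by omega : n - 1 < 0)]
    ring
  obtain ⟨n', rfl⟩ := Int.eq_ofNat_of_zero_le hn
  obtain ⟨j', rfl⟩ := Int.eq_ofNat_of_zero_le hj
  rw [hrCoeffZAB_natCast]
  cases n' with
  | zero =>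
    rw [show ((0 : ℕ) : ℤ) = 0 from rfl,
      opD2AB_apply_zero a b Δ _ (fun k => hrCoeffZAB_of_neg_left a b Δ ℓ (by norm_num) k)]
    rw [show hrCoeffZAB a b Δ ℓ 0 (j' : ℤ) = hrCoeffAB a b Δ ℓ 0 j' from hrCoeffZAB_natCast a b Δ ℓ 0 j']
    by_cases hjl : j' = ℓ
    · subst hjl; simp [d2diag_eq]
    · rw [hrCoeffAB_zero_of_ne a b Δ hjl]; ring
  | succ m =>
    push_cast
    rw [opD2AB_apply_succ]
    rw [show ((m : ℤ) + 1) = ((m + 1 : ℕ) : ℤ) by push_cast; ring, hrCoeffZAB_natCast,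
      show ((j' : ℤ) + 1) = ((j' + 1 : ℕ) : ℤ) by push_cast; ring, hrCoeffZAB_natCast,
      d2diag_eq, show ((j' : ℝ) + 1) = ((j' + 1 : ℕ) : ℝ) by push_cast; ring, d2dnAB_eq]
    -- the `j' - 1` parent
    have hup : d2upAB a b (Δ + (m : ℝ)) ((j' : ℝ) - 1) * hrCoeffZAB a b Δ ℓ (m : ℤ) ((j' : ℤ) - 1) =
        -(1/2) * (if j' = 0 then 0 else hrGammaPlusAB a b (Δ + m) (j' - 1) * hrCoeffAB a b Δ ℓ m (j' - 1)) := by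
      by_cases hj0 : j' = 0
      · subst hj0
        rw [if_pos rfl, hrCoeffZAB_of_neg_right _ _ _ _ _ (by norm_num)]
        ring
      · rw [if_neg hj0]
        obtain ⟨i, rfl⟩ : ∃ i, j' = i + 1 := ⟨j' - 1, by omega⟩
        rw [show ((i + 1 : ℕ) : ℤ) - 1 = (i : ℤ) by push_cast; ring, hrCoeffZAB_natCast,
          show (((i + 1 : ℕ)) : ℝ) - 1 = ((i : ℕ) : ℝ) by push_cast; ring, d2upAB_eq,
          Nat.add_sub_cancel]
        ring
    rw [hup]
    by_cases hpiv : casimirPivot3D Δ ℓ (m + 1) j' = 0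
    · -- off the descendant range: everything vanishes
      have hout : ¬ InDescendantRange ℓ (m + 1) j' := by
        intro hr
        exact (casimirPivot3D_pos hΔ (by omega) hr.1 hr.2.1 hr.2.2).ne' hpiv
      have hp1 : ¬ InDescendantRange ℓ m (j' + 1) := by
        rintro ⟨a', b', c'⟩; exact hout ⟨by omega, by omega, by omega⟩
      rw [hrCoeffAB_eq_zero_of_not_inDescendantRange a b Δ hout,
        hrCoeffAB_eq_zero_of_not_inDescendantRange a b Δ hp1]
      by_cases hj0 : j' = 0
      · simp [hj0]
      · have hp2 : ¬ InDescendantRange ℓ m (j' - 1) := by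
          rintro ⟨a', b', c'⟩; exact hout ⟨by omega, by omega, by omega⟩
        rw [if_neg hj0, hrCoeffAB_eq_zero_of_not_inDescendantRange a b Δ hp2]
        ring
    · have hrec := hrCoeffAB_succ_rec (a := a) (b := b) (Δ := Δ) (ℓ := ℓ) (n := m) (j := j') hpiv
      have hpe := casimirPivot3D_eq Δ ℓ (m + 1) j'
      push_cast at hpe
      have key : (casimirEigenvalue3D (Δ + ((m : ℝ) + 1)) j' - casimirEigenvalue3D Δ ℓ) *
          hrCoeffAB a b Δ ℓ (m + 1) j' =
          (1/2) * ((if j' = 0 then 0 else hrGammaPlusAB a b (Δ + m) (j' - 1) * hrCoeffAB a b Δ ℓ m (j' - 1)) +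
            hrGammaMinusAB a b (Δ + m) (j' + 1) * hrCoeffAB a b Δ ℓ m (j' + 1)) := by
        rw [← hrec, hpe]; ring
      linarith [key]

/-- **Uniqueness of range-supported eigen-arrays with given apex** (all `a, b`). If `y : ℤ → ℤ → ℝ` vanishes
off the descendant range of `(Δ, ℓ)`, satisfies `𝒟₂^{(a,b)} y = C_{Δ,ℓ} y`, and has apex `y_{0,j} = c δ_{jℓ}`,
then `y = c · A(a,b;Δ,ℓ)` (`Δ` above the unitarity bound: the pivots on the range are positive).
[cite: DolanOsborn2004, §3 eqs. (3.9)–(3.12)] -/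
theorem eq_smul_hrCoeffZAB_of_eigen {Δ : ℝ} {ℓ : ℕ} {a b : ℝ} (hΔ : unitarityBound3D ℓ < Δ)
    {y : ℤ → ℤ → ℝ} {c : ℝ}
    (hsupp : ∀ n j, ¬ InRangeZ ℓ n j → y n j = 0)
    (heig : opD2AB a b Δ y = fun n j => casimirEigenvalue3D Δ ℓ * y n j)
    (hapex : ∀ j : ℤ, y 0 j = if j = ℓ then c else 0) :
    y = fun n j => c * hrCoeffZAB a b Δ ℓ n j := by
  have hnat : ∀ n : ℕ, ∀ j : ℕ, y n j = c * hrCoeffAB a b Δ ℓ n j := by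
    intro n
    induction n with
    | zero =>
      intro j
      rw [show ((0 : ℕ) : ℤ) = 0 from rfl, hapex]
      by_cases h : j = ℓ
      · subst h; simp
      · rw [if_neg (by exact_mod_cast h), hrCoeffAB_zero_of_ne a b Δ h]; ring
    | succ m ih =>
      intro j
      by_cases hr : InDescendantRange ℓ (m + 1) j
      · have hpiv := casimirPivot3D_pos hΔ (by omega) hr.1 hr.2.1 hr.2.2
        have hpe := casimirPivot3D_eq Δ ℓ (m + 1) j
        have he := congrFun (congrFun heig ((m + 1 : ℕ) : ℤ)) (j : ℤ)
        push_cast at he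
        rw [opD2AB_apply_succ] at he
        -- parents at level `m`
        have hp_up : d2upAB a b (Δ + (m : ℝ)) ((j : ℝ) - 1) * y m ((j : ℤ) - 1) =
            c * (-(1/2) * (if j = 0 then 0 else hrGammaPlusAB a b (Δ + m) (j - 1) * hrCoeffAB a b Δ ℓ m (j - 1))) := by
          by_cases hj0 : j = 0
          · subst hj0
            have hz : y (m : ℤ) (-1) = 0 :=
              hsupp _ _ (fun h => by obtain ⟨h, _⟩ := h; norm_num at h)
            rw [if_pos rfl]
            push_cast
            simp [hz]
          · rw [if_neg hj0]
            obtain ⟨i, rfl⟩ : ∃ i, j = i + 1 := ⟨j - 1, by omega⟩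
            rw [show ((i + 1 : ℕ) : ℤ) - 1 = (i : ℤ) by push_cast; ring, ih,
              show (((i + 1 : ℕ)) : ℝ) - 1 = ((i : ℕ) : ℝ) by push_cast; ring, d2upAB_eq, Nat.add_sub_cancel]
            ring
        have hp_dn : d2dnAB a b (Δ + (m : ℝ)) ((j : ℝ) + 1) * y m ((j : ℤ) + 1) =
            c * (-(1/2) * (hrGammaMinusAB a b (Δ + m) (j + 1) * hrCoeffAB a b Δ ℓ m (j + 1))) := by
          rw [show ((j : ℤ) + 1) = ((j + 1 : ℕ) : ℤ) by push_cast; ring, ih,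
            show ((j : ℝ) + 1) = ((j + 1 : ℕ) : ℝ) by push_cast; ring, d2dnAB_eq]
          ring
        rw [hp_up, hp_dn, d2diag_eq, show ((m : ℤ) + 1) = ((m + 1 : ℕ) : ℤ) by push_cast; ring] at he
        have hrec := hrCoeffAB_succ_rec (a := a) (b := b) (Δ := Δ) (ℓ := ℓ) (n := m) (j := j) hpiv.ne'
        push_cast at hpe
        have h1 : (casimirEigenvalue3D (Δ + ((m : ℝ) + 1)) j - casimirEigenvalue3D Δ ℓ) * y ↑(m + 1) ↑j =
            c * ((1/2) * (casimirPivot3D Δ ℓ (m + 1) j * hrCoeffAB a b Δ ℓ (m + 1) j)) := by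
          rw [hrec]; linarith [he]
        rw [hpe] at h1
        have hne : casimirEigenvalue3D (Δ + ((m : ℝ) + 1)) j - casimirEigenvalue3D Δ ℓ ≠ 0 := by
          intro h0; rw [hpe, h0] at hpiv; linarith
        have h2 : (casimirEigenvalue3D (Δ + ((m : ℝ) + 1)) j - casimirEigenvalue3D Δ ℓ) *
            (y ↑(m + 1) ↑j - c * hrCoeffAB a b Δ ℓ (m + 1) j) = 0 := by linarith [h1]
        rcases mul_eq_zero.mp h2 with h | h
        · exact absurd h hne
        · linarith
      · rw [hsupp _ _ (by rwa [inRangeZ_natCast]), hrCoeffAB_eq_zero_of_not_inDescendantRange a b Δ hr]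
        ring
  funext n j
  by_cases hnj : InRangeZ ℓ n j
  · obtain ⟨hj, h1, _, _⟩ := hnj
    have hn : 0 ≤ n := by omega
    obtain ⟨n', rfl⟩ := Int.eq_ofNat_of_zero_le hn
    obtain ⟨j', rfl⟩ := Int.eq_ofNat_of_zero_le hj
    rw [hnat, hrCoeffZAB_natCast]
  · rw [hsupp _ _ hnj, hrCoeffZAB_eq_zero_of_not_inRangeZ _ _ _ _ hnj]; ring

/-- The `(a,b)` closure stencil maps arrays supported on the descendant range of `(Δ,ℓ)` to arrays supported
there. [folklore] -/
theorem opLAB_eq_zero_of_not_inRangeZ (a b s E₀ : ℝ) (ℓ : ℕ) {x : ℤ → ℤ → ℝ}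
    (hx : ∀ n j, ¬ InRangeZ ℓ n j → x n j = 0) {n j : ℤ} (h : ¬ InRangeZ ℓ n j) :
    opLAB a b s E₀ x n j = 0 := by
  simp only [opLAB]
  by_cases hj : 0 ≤ j
  · have o1 : ¬ InRangeZ ℓ (n - 1) (j - 1) := by
      rintro ⟨a', b', c', d'⟩; apply h; refine ⟨hj, by omega, by omega, ?_⟩
      obtain ⟨k, hk⟩ := d'; exact ⟨k + 1, by omega⟩
    have o2 : ¬ InRangeZ ℓ (n - 1) (j + 1) := by
      rintro ⟨a', b', c', d'⟩; apply h; refine ⟨hj, by omega, by omega, ?_⟩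
      obtain ⟨k, hk⟩ := d'; exact ⟨k, by omega⟩
    have o3 : ¬ InRangeZ ℓ (n - 2) j := by
      rintro ⟨a', b', c', d'⟩; apply h; refine ⟨hj, by omega, by omega, ?_⟩
      obtain ⟨k, hk⟩ := d'; exact ⟨k + 1, by omega⟩
    rw [hx _ _ h, hx _ _ o1, hx _ _ o2, hx _ _ o3]
    ring
  · have hj' : j < 0 := not_le.mp hj
    have z1 : x n j = 0 := hx _ _ (fun hh => by obtain ⟨a', _⟩ := hh; omega)
    have z2 : x (n - 1) (j - 1) = 0 := hx _ _ (fun hh => by obtain ⟨a', _⟩ := hh; omega)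
    have z4 : x (n - 2) j = 0 := hx _ _ (fun hh => by obtain ⟨a', _⟩ := hh; omega)
    rw [z1, z2, z4]
    rcases lt_or_eq_of_le (show j + 1 ≤ 0 by omega) with hlt | heq
    · rw [hx _ _ (fun hh => by obtain ⟨a', _⟩ := hh; omega)]; ring
    · rw [heq]; push_cast; simp

/-- **The `(a,b)` block array is an eigen-array of the `(a,b)` closure stencil**: for `Δ` strictly above the
unitarity bound and every `a, b, s`, `𝕃^{(a,b)}_s A(a,b;Δ,ℓ) = ℓ_s(Δ,ℓ) A(a,b;Δ,ℓ)` with the `a,b`-FREE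
diagonal symbol `ℓ_s(Δ,ℓ) = clDiag s Δ ℓ`. Proof: `𝕃 A` is again a range-supported eigen-array of `𝒟₂^{(a,b)}`
(commutation) with apex `ℓ_s(Δ,ℓ) δ_{jℓ}`, so uniqueness applies. [cite: DolanOsborn2011, §4.2] -/
theorem opLAB_hrCoeffZAB {Δ : ℝ} {ℓ : ℕ} (a b : ℝ) (hΔ : unitarityBound3D ℓ < Δ) (s : ℝ) :
    opLAB a b s Δ (hrCoeffZAB a b Δ ℓ) = fun n j => clDiag s Δ ℓ * hrCoeffZAB a b Δ ℓ n j := by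
  have hsuppA : ∀ n j, ¬ InRangeZ ℓ n j → hrCoeffZAB a b Δ ℓ n j = 0 :=
    fun n j h => hrCoeffZAB_eq_zero_of_not_inRangeZ a b Δ ℓ h
  apply eq_smul_hrCoeffZAB_of_eigen hΔ
  · exact fun n j h => opLAB_eq_zero_of_not_inRangeZ a b s Δ ℓ hsuppA h
  · rw [opD2AB_opLAB_comm, opD2AB_hrCoeffZAB a b hΔ, opLAB_smul]
  · intro j
    rw [opLAB_apply_zero a b s Δ _ (fun k => hrCoeffZAB_of_neg_left a b Δ ℓ (by norm_num) k)
      (fun k => hrCoeffZAB_of_neg_left a b Δ ℓ (by norm_num) k)]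
    by_cases hj0 : 0 ≤ j
    · obtain ⟨j', rfl⟩ := Int.eq_ofNat_of_zero_le hj0
      rw [show hrCoeffZAB a b Δ ℓ 0 (j' : ℤ) = hrCoeffAB a b Δ ℓ 0 j' from hrCoeffZAB_natCast a b Δ ℓ 0 j']
      by_cases hj : j' = ℓ
      · subst hj; simp
      · rw [if_neg (by exact_mod_cast hj), hrCoeffAB_zero_of_ne a b Δ hj]; ring
    · rw [hrCoeffZAB_of_neg_right _ _ _ _ _ (not_le.mp hj0), if_neg (by omega)]
      ring

end Literature.MathematicalPhysics.QuantumFieldTheory.ConformalBootstrap3D
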